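import Summits.BirchSwinnertonDyer.BirchSwinnertonDyer.Theorems.GenusKolyvaginAtTwoGenusPrimitiveSupplyAtTwoArchimedeanEggTwistLaw
import Summits.BirchSwinnertonDyer.BirchSwinnertonDyer.Theorems.GenusKolyvaginAtTwoGenusPrimitiveSupplyAtTwoTwistSelmerStrictUp
import Summits.BirchSwinnertonDyer.BirchSwinnertonDyer.Theses.GenusKolyvaginAtTwo
import Literature.NumberTheory.QuadraticFields.FundamentalDiscriminant
import Literature.NumberTheory.EllipticCurves.HeegnerHypothesisKroneckerProofs
import Literature.NumberTheory.EllipticCurves.HeegnerFieldOfDiscriminantProofs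
import Literature.NumberTheory.EllipticCurves.ModularityVersionApProofs
import HarnessLib

/-!
# Route `GenusKolyvaginAtTwo`, crux #2 `GenusPrimitiveSupplyAtTwo` (stmt-BirchSwinnertonDyer-22136):
# the `-desc` packet BY NAME — T-A `AdmissibleTwistSelmerShiftAtTwo`, T-A′ `AdmissibleTwistSelmerLevelAtTwo`,
# T-V `StrictShaPropagationAtTwo`, T-C `EggTwistLawAtTwo` — modulo the ROUTE's print items
# {`ModularityExistsNewform`, `TwoParityDD`, `CasselsTatePairingRat`} ONLY (root-number parity; no image hypothesis)

Width seat `bsd-line-gk2-p5` g10 (cell `bsd-f1-sign2`, SUPPLY lineage), file 32 of the series (sequel of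
`…ArchimedeanEggTwistLaw.lean`). THEOREMS ONLY (no definition, no named fact, no `sorry`, no local instance); helper
`--supports stmt-BirchSwinnertonDyer-22136`; no item is closed; BSD is not proved by any of this.

WHY. Files 25–31 proved T-A / T-A′ / T-V / T-C ON THE HABITAT (`ρ̄_{W,2}` onto) modulo Kramer's congruence
`MazurRubin2010.kramerParity` — whose binder `huniq` (uniqueness of the intertwining `W^{(d)}[2] ≅ W[2]`) fails at the image-`C₃`
curves that the statements' hypothesis `NoRationalTwoTorsion` admits, so none of the four was reachable BY NAME. The parity input of
the UP direction has a second source with NO image hypothesis, the one of gk2-p4's `…TwistSelmerStrictUp` (p628133) at a finite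
twisting prime: `#Sel₂ = 2^s` with `(−1)^s = w` (the 2-parity theorem + Cassels–Tate, `E(ℚ)[2] = 0`) and `w(W^{(d)}) = −w(W)`. For a
descent-admissible `d` the twist IS a Heegner twist: `d < 0`, `d ≡ 1 (8)`, squarefree, its primes good, `(d/ℓ) = 1` at the odd bad `ℓ`
⟹ `ℚ(√d)` is imaginary quadratic of discriminant `d` with every `p ∣ N_W` split, so `w(W^{(d)}) = −w(W)` from modularity
(`rootNumber_quadraticTwist_discr_eq_neg_of_exists_isNewformOf`). Hence:

* §77 `rootNumber_quadraticTwist_eq_neg_of_descAdmissible` — `w(W^{(d)}) = −w(W)` for every descent-admissible `d`, modulo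
  `exists_isNewformOf`; `isSquare_twistSelmerTwoCard_mul_selmerTwoCard_mul_two` — `IsSquare (#Sel₂(W^{(d)}) · #Sel₂(W) · 2)`
  (the parity of the pair at `S = {∞}`) for `E(ℚ)[2] = 0`, modulo {modularity, 2-parity, Cassels–Tate}.
* §78 `natCard_selmerGroup_twist_eq_mul_two_of_places_inl_of_isSquare` (any number field, one real `T`-place, parity DISPLAYED as
  an `IsSquare` hypothesis — file 23's `…_of_parity` with Kramer's congruence replaced by the displayed square),
  `natCard_selmerGroup_twist_eq_mul_two_of_descAdmissible_of_strict_of_isSquare`, `twistSelmerTwoCard_eq_two_mul_of_strict_of_isSquare`.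
* §79 BY NAME, modulo the route items `ModularityExistsNewform` (19382), `TwoParityDD` (24949), `CasselsTatePairingRat` (19420)
  (Poitou–Tate and Tate χ are tree theorems): **`admissibleTwistSelmerShiftAtTwo_of_print` (T-A), `admissibleTwistSelmerLevelAtTwo_of_print`
  (T-A′), `strictShaPropagationAtTwo_of_print` (T-V), `eggTwistLawAtTwo_of_print` (T-C)** — the four `F1Sign2` statements with their
  printed hypotheses (`NoRationalTwoTorsion`, no Galois-image condition), as implications from the three print items BY NAME.

References: [Kramer1981] §2 Prop. 6, Thm. 1; [MazurRubin2010] Prop. 3.3, Cor. 3.4 (i); [DokchitserDokchitserAnnals2010] Thm. 1.4;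
[Cassels1962ArithmeticIV]; [Darmon2004] §3.6 Thm. 3.17; [BCDTJAMS2001] Thm. A; [MilneADT2006] I Thm. 2.8, 2.13, 4.10, 6.13.
-/

set_option linter.dupNamespace false -- tree convention: `Summit.BirchSwinnertonDyer.BirchSwinnertonDyer.Theorems` (summit = sub-problem)
set_option autoImplicit false

noncomputable section

open scoped Classical ContRepresentation AddSubgroup

namespace Summit.BirchSwinnertonDyer.BirchSwinnertonDyer.Theorems.GenusKolyArch

open WeierstrassCurve Field NumberField IsDedekindDomain Function
open Literature.NumberTheory.EllipticCurves Literature.NumberTheory.GaloisRepresentations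
open Literature.NumberTheory.GaloisRepresentations.DiscreteGaloisModule (SelmerStructure)
open Literature.NumberTheory.GaloisCohomology
open Literature.NumberTheory.EllipticCurves.ModularForms (exists_isNewformOf)
open Summit.BirchSwinnertonDyer.Rank1Residual.F1Sign2
open Summit.BirchSwinnertonDyer.BirchSwinnertonDyer.Theorems.GenusKolyTwistLocal
open Summit.BirchSwinnertonDyer.BirchSwinnertonDyer.Theorems.SchneiderFreeAdditiveX3.PoitouTateReduction
  (poitouTate_selmerStructure_duality_real_holds)
open Summit.BirchSwinnertonDyer.BirchSwinnertonDyer.Theses.GenusKolyvaginAtTwo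
  (ModularityExistsNewform TwoParityDD CasselsTatePairingRat)

/-! ## §77 The root number of a descent-admissible twist; the parity of the pair at `S = {∞}` -/

section RootNumber

variable (W : WeierstrassCurve ℚ) [W.IsElliptic] [W.IsGloballyMinimal]

/-- **`w(W^{(d)}) = −w(W)` for a descent-admissible `d`** (modulo the Modularity Theorem `exists_isNewformOf`): `d < 0`, `d ≡ 1 (mod 8)`
squarefree, primes of `d` good, `(d/ℓ) = 1` at odd bad `ℓ` ⟹ the field of discriminant `d` (`Quadratic.exists_numberField_discr_eq`) is
imaginary quadratic and satisfies the Heegner hypothesis for `N_W` (decomposition law `satisfiesHeegnerHypothesis_iff_kronecker`;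
`p ∣ N_W ⟺ p` bad, `dvd_conductorNorm_iff_not_hasGoodReductionAtPrime`), so the twist has the opposite root number
(`rootNumber_quadraticTwist_discr_eq_neg_of_exists_isNewformOf`). [cite: Darmon2004, §3.6 Thm. 3.17 and p. 39] [cite: BCDTJAMS2001, Thm. A] -/
theorem rootNumber_quadraticTwist_eq_neg_of_descAdmissible (hmod : exists_isNewformOf) {d : ℤ} (hd : DescAdmissible W d) :
    (W.quadraticTwist (d : ℚ)).rootNumber = -W.rootNumber := by
  obtain ⟨hdneg, hsqf, hd8, _, hbad⟩ := hd
  have hd4 : d % 4 = 1 := by omega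
  have hd1 : d ≠ 1 := by omega
  obtain ⟨K, _, _, h2, hdK⟩ :=
    Literature.NumberTheory.QuadraticFields.Quadratic.exists_numberField_discr_eq (Or.inl ⟨hd4, hsqf, hd1⟩)
  have hK : IsImaginaryQuadratic K := isImaginaryQuadratic_of_discr_eq_of_neg h2 hdK hdneg
  have hH : SatisfiesHeegnerHypothesis (W.conductorNorm ℤ) K := by
    rw [satisfiesHeegnerHypothesis_iff_kronecker _ _ h2, hdK]
    intro p hp hpN
    haveI : Fact p.Prime := ⟨hp⟩
    have hbadp : ¬ W.HasGoodReductionAtPrime p := (W.dvd_conductorNorm_iff_not_hasGoodReductionAtPrime p).mp hpN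
    exact ⟨fun _ ↦ hd8, fun hp2 ↦ hbad p hp hp2 fun _ ↦ hbadp⟩
  have h := rootNumber_quadraticTwist_discr_eq_neg_of_exists_isNewformOf W K hmod hK hH
  rwa [hdK] at h

omit [W.IsElliptic] [W.IsGloballyMinimal] in
/-- `E(ℚ)[2] = 0` in subgroup form, from `NoRationalTwoTorsion`. [cite: SilvermanAEC2009, III.2.3 (d)] -/
theorem torsionBy_two_eq_bot_of_noRationalTwoTorsion (hT : NoRationalTwoTorsion W) : W.toAffine.Point[(2 : ℤ)] = ⊥ :=
  Summit.BirchSwinnertonDyer.Uniform.U2.torsionBy_two_eq_bot_iff.mpr fun P hP ↦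
    EggDoubling.eq_zero_of_two_smul_eq_zero W hT P hP

/-- **The parity of the pair `(W, W^{(d)})` from PER-CURVE `2`-parity inputs** (R-128: Dokchitser–Dokchitser used only at the ELLIPTIC curves `W`, `W^{(d)}`;
callers pass the print form `∀ (V) [V.IsElliptic], p_parity V 2` as `hDD W`, `hDD _`). [cite: DokchitserDokchitserAnnals2010, Thm. 1.4] [cite: Cassels1962ArithmeticIV] [cite: Darmon2004, §3.6 Thm. 3.17] -/
theorem isSquare_twistSelmerTwoCard_mul_selmerTwoCard_mul_two_of_parity (hmod : exists_isNewformOf)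
    (hCT : WeierstrassCurve.exists_casselsTate_pairing (K := ℚ)) (hT : NoRationalTwoTorsion W) {d : ℤ} (hd : DescAdmissible W d)
    (hparW : p_parity W 2) (hpard : ∀ [(W.quadraticTwist ((d : ℤ) : ℚ)).IsElliptic], p_parity (W.quadraticTwist ((d : ℤ) : ℚ)) 2) :
    IsSquare (twistSelmerTwoCard W d * selmerTwoCard W * 2) := by
  haveI : Fact (Nat.Prime 2) := ⟨Nat.prime_two⟩; have hd0 : ((d : ℤ) : ℚ) ≠ 0 := by exact_mod_cast hd.1.ne
  haveI := W.isElliptic_quadraticTwist hd0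
  obtain ⟨s, hsW⟩ : ∃ s, Nat.card (W.selmerGroup 2) = 2 ^ s := Literature.NumberTheory.EllipticCurves.exists_natCard_selmerGroup_eq_pow W 2
  obtain ⟨s', hsWd⟩ : ∃ s', Nat.card ((W.quadraticTwist ((d : ℤ) : ℚ)).selmerGroup 2) = 2 ^ s' :=
    Literature.NumberTheory.EllipticCurves.exists_natCard_selmerGroup_eq_pow (W.quadraticTwist ((d : ℤ) : ℚ)) 2
  have hbotW : W.toAffine.Point[(2 : ℤ)] = ⊥ := torsionBy_two_eq_bot_of_noRationalTwoTorsion W hT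
  have hbotWd : (W.quadraticTwist ((d : ℤ) : ℚ)).toAffine.Point[(2 : ℤ)] = ⊥ :=
    Summit.BirchSwinnertonDyer.Uniform.U2.torsionBy_two_eq_bot_of_twist W hd0 _ ⟨1, one_smul _ _⟩ hbotW
  have hwW : (-1 : ℤ) ^ s = W.rootNumber := neg_one_pow_eq_rootNumber_of_torsionBy_two_eq_bot W hparW hCT hbotW hsW
  have hwWd : (-1 : ℤ) ^ s' = (W.quadraticTwist ((d : ℤ) : ℚ)).rootNumber :=
    neg_one_pow_eq_rootNumber_of_torsionBy_two_eq_bot _ hpard hCT hbotWd hsWd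
  have htw := rootNumber_quadraticTwist_eq_neg_of_descAdmissible W hmod hd; have hne : s' % 2 ≠ s % 2 := by
    intro heq
    have h1 : (-1 : ℤ) ^ s' = (-1) ^ s := by rw [neg_one_pow_eq_pow_mod_two, heq, ← neg_one_pow_eq_pow_mod_two]
    rw [hwW, hwWd, htw] at h1
    exact pow_ne_zero s (by norm_num) (hwW.trans (by linarith : W.rootNumber = 0))
  obtain ⟨k, hk⟩ : ∃ k, s' + s + 1 = 2 * k := ⟨(s' + s + 1) / 2, by omega⟩
  exact ⟨2 ^ k, by rw [twistSelmerTwoCard, selmerTwoCard, hsWd, hsW, ← pow_add, ← pow_succ, hk, two_mul, pow_add]⟩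

/-- **The parity of the pair `(W, W^{(d)})` at `S = {∞}`, from root numbers**: for `W/ℚ` globally minimal elliptic with `E(ℚ)[2] = 0`
and `d` descent-admissible, `#Sel₂(W^{(d)}) · #Sel₂(W) · 2` is a square — `#Sel₂ = 2^s`, `(−1)^s = w` on both curves (2-parity
theorem + Cassels–Tate, no rational `2`-torsion on either: gk2-p4 `neg_one_pow_eq_rootNumber_of_torsionBy_two_eq_bot`), and
`w(W^{(d)}) = −w(W)` (§77), so `s(W^{(d)}) + s(W) + 1` is even. This is the input Kramer's congruence supplies on the habitat, here
WITHOUT any Galois-image hypothesis. [cite: DokchitserDokchitserAnnals2010, Thm. 1.4] [cite: Cassels1962ArithmeticIV]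
[cite: Darmon2004, §3.6 Thm. 3.17] -/
theorem isSquare_twistSelmerTwoCard_mul_selmerTwoCard_mul_two (hmod : exists_isNewformOf)
    (hpar : ∀ V : WeierstrassCurve ℚ, p_parity V 2) (hCT : WeierstrassCurve.exists_casselsTate_pairing (K := ℚ))
    (hT : NoRationalTwoTorsion W) {d : ℤ} (hd : DescAdmissible W d) :
    IsSquare (twistSelmerTwoCard W d * selmerTwoCard W * 2) :=
  isSquare_twistSelmerTwoCard_mul_selmerTwoCard_mul_two_of_parity W hmod hCT hT hd (hpar W) (hpar _)

end RootNumber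

/-! ## §78 UP with one real `T`-place, the parity DISPLAYED as a square (no Kramer congruence, no image hypothesis) -/

section UpIsSquare

variable {K : Type} [Field K] [NumberField K] (W : WeierstrassCurve K) [W.IsElliptic]

/-- **Cor. 3.4 (i) UP with a single REAL `T`-place, from the place menu, the parity of the pair DISPLAYED** as
`IsSquare (#Sel₂(Wd) · #Sel₂(W) · 2)` — file 23's `natCard_selmerGroup_twist_eq_mul_two_of_places_inl_of_parity` with Kramer's
congruence replaced by the displayed square (so: no `ρ̄₂`-surjectivity, no uniqueness of the intertwining). Kernel theorem modulo
Poitou–Tate duality and Tate's χ. [cite: MazurRubin2010, Prop. 3.3, Cor. 3.4 (i), Lemma 2.9] [cite: Kramer1981, §2 Prop. 6]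
[cite: MilneADT2006, I Thm. 2.13, 4.10] -/
theorem natCard_selmerGroup_twist_eq_mul_two_of_places_inl_of_isSquare
    (hPT : poitouTate_selmerStructure_duality_real K)
    (hEP : ∀ v : HeightOneSpectrum (𝓞 K), localEulerPoincareCharacteristic (v.adicCompletion K))
    {Wd : WeierstrassCurve K} [Wd.IsElliptic] {d : K}
    (φ : (Wd.torsionGaloisModule ((2 : ℕ) : ℤ)).toContRepresentation →ⁱL
      (W.torsionGaloisModule ((2 : ℕ) : ℤ)).toContRepresentation)
    (ψ : (W.torsionGaloisModule ((2 : ℕ) : ℤ)).toContRepresentation →ⁱL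
      (Wd.torsionGaloisModule ((2 : ℕ) : ℤ)).toContRepresentation)
    (hψφ : ∀ a, ψ (φ a) = a) (hφψ : ∀ b, φ (ψ b) = b)
    (hsplit : ∀ (E : Type) [Field E] [Algebra K E], (∃ s : E, s ^ 2 = algebraMap K E d) →
      (Wd.kummerLocalConditionAt ((2 : ℕ) : ℤ) E).map (galoisCohomology.map (φ.restrictField E) 1) =
        W.kummerLocalConditionAt ((2 : ℕ) : ℤ) E)
    {w₀ : InfinitePlace K} (hw₀ : w₀.IsReal) (hΔ : 0 < InfinitePlace.embedding_of_isReal hw₀ W.Δ)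
    (hfin : ∀ v : HeightOneSpectrum (𝓞 K),
      (∃ s : v.adicCompletion K, s ^ 2 = algebraMap K (v.adicCompletion K) d) ∨
      (((2 : ℕ) : 𝓞 K) ∉ v.asIdeal ∧ W.HasGoodReductionAt v ∧ Wd.HasGoodReductionAt v) ∨
      (((2 : ℕ) : 𝓞 K) ∉ v.asIdeal ∧
        Nat.card (nsmulAddMonoidHom 2 : (W.baseChange (v.adicCompletion K)).toAffine.Point →+ _).ker = 1 ∧
        Nat.card (nsmulAddMonoidHom 2 : (Wd.baseChange (v.adicCompletion K)).toAffine.Point →+ _).ker = 1))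
    (hinf : ∀ w : InfinitePlace K, w ≠ w₀ →
      (∃ s : w.Completion, s ^ 2 = algebraMap K w.Completion d) ∨
      ((∀ x : galoisCohomology (W.localGaloisModule w.Completion) 1, x = 0) ∧
        (∀ x : galoisCohomology (Wd.localGaloisModule w.Completion) 1, x = 0)))
    (htr : (Wd.kummerLocalConditionAt ((2 : ℕ) : ℤ) w₀.Completion).map
        (galoisCohomology.map (φ.restrictField w₀.Completion) 1) ⊓
      W.kummerLocalConditionAt ((2 : ℕ) : ℤ) w₀.Completion = ⊥)
    (hstrict : ∀ c ∈ (W.kummerSelmerStructure ((2 : ℕ) : ℤ)).selmerGroup,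
      galoisCohomology.localization (W.torsionGaloisModule ((2 : ℕ) : ℤ)) (Sum.inl w₀) 1 c = 0)
    (hsq : IsSquare (Nat.card (Wd.selmerGroup ((2 : ℕ) : ℤ)) * Nat.card (W.selmerGroup ((2 : ℕ) : ℤ)) * 2)) :
    Nat.card (Wd.selmerGroup ((2 : ℕ) : ℤ)) = Nat.card (W.selmerGroup ((2 : ℕ) : ℤ)) * 2 := by
  haveI : Fact (Nat.Prime 2) := ⟨Nat.prime_two⟩
  let 𝓐 : SelmerStructure (W.torsionGaloisModule ((2 : ℕ) : ℤ)) := fun v ↦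
    (Wd.kummerSelmerStructure ((2 : ℕ) : ℤ) v).map (galoisCohomology.map (φ.restrictField (Place.Completion v)) 1)
  have h𝓐 : ∀ v, 𝓐 v = (Wd.kummerSelmerStructure ((2 : ℕ) : ℤ) v).map
      (galoisCohomology.map (φ.restrictField (Place.Completion v)) 1) := fun _ ↦ rfl
  have hagree := transport_twist_agree_off_inl W φ ψ hφψ hsplit 𝓐 h𝓐 w₀ hfin hinf
  have htr' : 𝓐 (Sum.inl w₀) ⊓ W.kummerSelmerStructure ((2 : ℕ) : ℤ) (Sum.inl w₀) = ⊥ := by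
    rw [h𝓐, kummerSelmerStructure_apply, kummerSelmerStructure_apply]
    exact htr
  have ht : Nat.card (W.kummerSelmerStructure ((2 : ℕ) : ℤ) (Sum.inl w₀)) = 2 :=
    natCard_kummerSelmerStructure_inl_eq_two_of_isReal W hw₀ hΔ
  have hpar : IsSquare (Nat.card (Wd.selmerGroup ((2 : ℕ) : ℤ)) * Nat.card (W.selmerGroup ((2 : ℕ) : ℤ)) *
      (𝓐 (Sum.inl w₀)).relIndex (W.kummerSelmerStructure ((2 : ℕ) : ℤ) (Sum.inl w₀))) := by
    have hrel : (𝓐 (Sum.inl w₀)).relIndex (W.kummerSelmerStructure ((2 : ℕ) : ℤ) (Sum.inl w₀)) = 2 := by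
      rw [← AddSubgroup.inf_relIndex_right, htr', AddSubgroup.relIndex_bot_left, ht]
    rw [hrel]
    exact hsq
  exact natCard_selmerGroup_eq_mul_of_transverse_inl_of_forall_localization_eq_zero W Wd 2 hPT hEP φ ψ hψφ hφψ 𝓐 h𝓐 w₀
    hagree htr' ht hstrict hpar

end UpIsSquare

section UpRat

variable (W : WeierstrassCurve ℚ) [W.IsElliptic] [W.IsGloballyMinimal]

/-- **UP for a descent-admissible twist when `Sel₂(W)` is strict at `∞`, the parity DISPLAYED** — file 27's
`natCard_selmerGroup_twist_eq_mul_two_of_descAdmissible_of_strict` with {Kramer parity, `ρ̄₂` onto} replaced by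
`IsSquare (#Sel₂(Wd) · #Sel₂(W) · 2)`; modulo {PT, Tate χ}. [cite: MazurRubin2010, Prop. 3.3, Cor. 3.4 (i)] [cite: Kramer1981, §2 Prop. 6] -/
theorem natCard_selmerGroup_twist_eq_mul_two_of_descAdmissible_of_strict_of_isSquare
    (hPT : poitouTate_selmerStructure_duality_real ℚ)
    (hEP : ∀ v : HeightOneSpectrum (𝓞 ℚ), localEulerPoincareCharacteristic (v.adicCompletion ℚ))
    (hΔ : 0 < W.Δ) {d : ℤ} (hd : DescAdmissible W d) {Wd : WeierstrassCurve ℚ} [Wd.IsElliptic] {C : VariableChange ℚ}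
    (hC : C • W.quadraticTwist (d : ℚ) = Wd)
    (hstrict : ∀ c ∈ (W.kummerSelmerStructure ((2 : ℕ) : ℤ)).selmerGroup,
      galoisCohomology.localization (W.torsionGaloisModule ((2 : ℕ) : ℤ)) (Sum.inl Rat.infinitePlace) 1 c = 0)
    (hsq : IsSquare (Nat.card (Wd.selmerGroup ((2 : ℕ) : ℤ)) * Nat.card (W.selmerGroup ((2 : ℕ) : ℤ)) * 2)) :
    Nat.card (Wd.selmerGroup 2) = Nat.card (W.selmerGroup 2) * 2 := by
  have hdneg : d < 0 := hd.1
  have hd0' : ((d : ℤ) : ℚ) ≠ 0 := by exact_mod_cast hdneg.ne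
  obtain ⟨φ, ψ, hψφ, hφψ, hsplit, hreal⟩ := exists_intertwining_hsplit_and_transverse_inl W hd0' hC
  have hw₀ : (Rat.infinitePlace).IsReal := Rat.isReal_infinitePlace
  have hΔ' : 0 < InfinitePlace.embedding_of_isReal hw₀ W.Δ := by rwa [embedding_of_isReal_rat_apply, Rat.cast_pos]
  have hinf : ∀ w : InfinitePlace ℚ, w ≠ Rat.infinitePlace →
      (∃ s : w.Completion, s ^ 2 = algebraMap ℚ w.Completion ((d : ℤ) : ℚ)) ∨
      ((∀ x : galoisCohomology (W.localGaloisModule w.Completion) 1, x = 0) ∧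
        (∀ x : galoisCohomology (Wd.localGaloisModule w.Completion) 1, x = 0)) :=
    fun w hw ↦ absurd (Subsingleton.elim w _) hw
  have h := natCard_selmerGroup_twist_eq_mul_two_of_places_inl_of_isSquare W hPT hEP φ ψ hψφ hφψ hsplit hw₀ hΔ'
    (descAdmissible_place_menu W hd hC φ ψ hψφ hφψ) hinf
    (hreal _ hw₀ hΔ' (forall_sq_ne_completion_of_neg (by exact_mod_cast hdneg) _)) hstrict hsq
  simpa only [Nat.cast_ofNat] using h

/-- **UP in the cell's currency, parity displayed**: `Sel₂(W)` strict at `∞` and `IsSquare (#Sel₂(W^{(d)}) · #Sel₂(W) · 2)` ⟹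
`#Sel₂(W^{(d)}) = 2·#Sel₂(W)`, for every descent-admissible `d`; modulo {PT, Tate χ}. [cite: MazurRubin2010, Prop. 3.3, Cor. 3.4 (i)] -/
theorem twistSelmerTwoCard_eq_two_mul_of_strict_of_isSquare
    (hPT : poitouTate_selmerStructure_duality_real ℚ)
    (hEP : ∀ v : HeightOneSpectrum (𝓞 ℚ), localEulerPoincareCharacteristic (v.adicCompletion ℚ))
    (hΔ : 0 < W.Δ)
    (hstrict : ∀ c ∈ (W.kummerSelmerStructure ((2 : ℕ) : ℤ)).selmerGroup,
      galoisCohomology.localization (W.torsionGaloisModule ((2 : ℕ) : ℤ)) (Sum.inl Rat.infinitePlace) 1 c = 0)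
    {d : ℤ} (hd : DescAdmissible W d) (hsq : IsSquare (twistSelmerTwoCard W d * selmerTwoCard W * 2)) :
    twistSelmerTwoCard W d = 2 * selmerTwoCard W := by
  have hd0 : d ≠ 0 := hd.1.ne
  haveI := W.isElliptic_quadraticTwist (show ((d : ℤ) : ℚ) ≠ 0 by exact_mod_cast hd0)
  have hC : (1 : VariableChange ℚ) • W.quadraticTwist ((d : ℤ) : ℚ) = W.quadraticTwist ((d : ℤ) : ℚ) := one_smul _ _
  have hcard := GenusKolyTwin.natCard_selmerGroup_model_eq_twistSelmerTwoCard W hd0 _ ⟨1, hC⟩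
  have hsq' : IsSquare (Nat.card ((W.quadraticTwist ((d : ℤ) : ℚ)).selmerGroup ((2 : ℕ) : ℤ)) *
      Nat.card (W.selmerGroup ((2 : ℕ) : ℤ)) * 2) := by
    simp only [Nat.cast_ofNat]
    rw [hcard]
    exact hsq
  have h := natCard_selmerGroup_twist_eq_mul_two_of_descAdmissible_of_strict_of_isSquare W hPT hEP hΔ hd hC hstrict hsq'
  rw [hcard] at h
  rw [h, selmerTwoCard, mul_comm]

end UpRat

/-! ## §79 T-A, T-A′, T-V, T-C BY NAME, modulo the route's print items -/

section ByName

section PerCurve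

variable (W : WeierstrassCurve ℚ) [W.IsElliptic] [W.IsGloballyMinimal]

/-- **T-A dichotomy for ONE curve from the DISPLAYED parity square** (`hpar`-free core of `admissibleTwistSelmerShiftAt_of_print`). [cite: Kramer1981, §2 Prop. 6, Thm. 1] [cite: MazurRubin2010, Cor. 3.4 (i)] -/
theorem admissibleTwistSelmerShiftAt_of_isSquare (hΔ : 0 < W.Δ) {d : ℤ} (hd : DescAdmissible W d)
    (hsq : IsSquare (twistSelmerTwoCard W d * selmerTwoCard W * 2)) :
    2 * twistSelmerTwoCard W d = selmerTwoCard W ∨ twistSelmerTwoCard W d = 2 * selmerTwoCard W := by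
  have hPT := poitouTate_selmerStructure_duality_real_holds (K := ℚ); have hEP := GenusKolyLowering.localEP ℚ
  by_cases hstrict : ∀ c ∈ (W.kummerSelmerStructure ((2 : ℕ) : ℤ)).selmerGroup,
      galoisCohomology.localization (W.torsionGaloisModule ((2 : ℕ) : ℤ)) (Sum.inl Rat.infinitePlace) 1 c = 0
  · exact Or.inr (twistSelmerTwoCard_eq_two_mul_of_strict_of_isSquare W hPT hEP hΔ hstrict hd hsq)
  · push Not at hstrict; obtain ⟨c, hc, hne⟩ := hstrict
    exact Or.inl (two_mul_twistSelmerTwoCard_eq_of_exists W hPT hEP hΔ ⟨c, hc, hne⟩ hd)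

/-- **T-A′ level law for ONE curve from the displayed parity squares** (`hpar`-free core of `admissibleTwistSelmerLevelAt_of_print`). [cite: Kramer1981, §2 Prop. 6, Thm. 1] [cite: MazurRubin2010, Cor. 3.4 (i)] -/
theorem admissibleTwistSelmerLevelAt_of_isSquare (hΔ : 0 < W.Δ) {d d' : ℤ} (hd : DescAdmissible W d) (hd' : DescAdmissible W d')
    (hsq : IsSquare (twistSelmerTwoCard W d * selmerTwoCard W * 2)) (hsq' : IsSquare (twistSelmerTwoCard W d' * selmerTwoCard W * 2)) :
    twistSelmerTwoCard W d = twistSelmerTwoCard W d' := by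
  have hPT := poitouTate_selmerStructure_duality_real_holds (K := ℚ); have hEP := GenusKolyLowering.localEP ℚ
  by_cases hstrict : ∀ c ∈ (W.kummerSelmerStructure ((2 : ℕ) : ℤ)).selmerGroup,
      galoisCohomology.localization (W.torsionGaloisModule ((2 : ℕ) : ℤ)) (Sum.inl Rat.infinitePlace) 1 c = 0
  · rw [twistSelmerTwoCard_eq_two_mul_of_strict_of_isSquare W hPT hEP hΔ hstrict hd hsq,
      twistSelmerTwoCard_eq_two_mul_of_strict_of_isSquare W hPT hEP hΔ hstrict hd' hsq']
  · push Not at hstrict; obtain ⟨c, hc, hne⟩ := hstrict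
    have h1 := two_mul_twistSelmerTwoCard_eq_of_exists W hPT hEP hΔ ⟨c, hc, hne⟩ hd
    have h2 := two_mul_twistSelmerTwoCard_eq_of_exists W hPT hEP hΔ ⟨c, hc, hne⟩ hd'; omega

/-- **T-V dichotomy for ONE curve from the displayed parity squares** (`hpar`-free core of `strictShaPropagationAt_of_print`). [cite: Kramer1981, §2 Prop. 6, Thm. 1] [cite: MazurRubin2010, Cor. 3.4 (i)] [cite: CremonaMazur2000, §3] -/
theorem strictShaPropagationAt_of_isSquare (hΔ : 0 < W.Δ) (h4 : selmerTwoCard W = 4)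
    (hsq : ∀ d : ℤ, DescAdmissible W d → IsSquare (twistSelmerTwoCard W d * selmerTwoCard W * 2)) :
    (∀ d : ℤ, DescAdmissible W d → twistSelmerTwoCard W d = 2) ∨
      (∀ d : ℤ, DescAdmissible W d → twistSelmerTwoCard W d = 8) := by
  have hPT := poitouTate_selmerStructure_duality_real_holds (K := ℚ); have hEP := GenusKolyLowering.localEP ℚ
  by_cases hstrict : ∀ c ∈ (W.kummerSelmerStructure ((2 : ℕ) : ℤ)).selmerGroup,
      galoisCohomology.localization (W.torsionGaloisModule ((2 : ℕ) : ℤ)) (Sum.inl Rat.infinitePlace) 1 c = 0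
  · exact Or.inr fun d hd ↦ by rw [twistSelmerTwoCard_eq_two_mul_of_strict_of_isSquare W hPT hEP hΔ hstrict hd (hsq d hd), h4]
  · push Not at hstrict; obtain ⟨c, hc, hne⟩ := hstrict
    exact Or.inl fun d hd ↦ by have h := two_mul_twistSelmerTwoCard_eq_of_exists W hPT hEP hΔ ⟨c, hc, hne⟩ hd; omega

/-- **The T-A dichotomy for ONE curve, modulo the three print items** (no Galois-image hypothesis): `Δ_W > 0`, `E(ℚ)[2] = 0`, `d`
descent-admissible ⟹ `2·#Sel₂(W^{(d)}) = #Sel₂(W)` (some Selmer class non-trivial at `∞`: DOWN, file 27) or `#Sel₂(W^{(d)}) = 2·#Sel₂(W)`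
(`Sel₂(W)` strict at `∞`: UP with the root-number parity §77–§78). [cite: Kramer1981, §2 Prop. 6, Thm. 1] [cite: MazurRubin2010, Cor. 3.4 (i)]
[cite: DokchitserDokchitserAnnals2010, Thm. 1.4] -/
theorem admissibleTwistSelmerShiftAt_of_print (hmod : exists_isNewformOf) (hpar : ∀ V : WeierstrassCurve ℚ, p_parity V 2)
    (hCT : WeierstrassCurve.exists_casselsTate_pairing (K := ℚ)) (hΔ : 0 < W.Δ) (hT : NoRationalTwoTorsion W)
    {d : ℤ} (hd : DescAdmissible W d) :
    2 * twistSelmerTwoCard W d = selmerTwoCard W ∨ twistSelmerTwoCard W d = 2 * selmerTwoCard W :=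
  admissibleTwistSelmerShiftAt_of_isSquare W hΔ hd (isSquare_twistSelmerTwoCard_mul_selmerTwoCard_mul_two W hmod hpar hCT hT hd)

/-- **The T-A′ level law for ONE curve, modulo the three print items**: all descent-admissible twists have the same `#Sel₂`.
[cite: Kramer1981, §2 Prop. 6, Thm. 1] [cite: MazurRubin2010, Cor. 3.4 (i)] -/
theorem admissibleTwistSelmerLevelAt_of_print (hmod : exists_isNewformOf) (hpar : ∀ V : WeierstrassCurve ℚ, p_parity V 2)
    (hCT : WeierstrassCurve.exists_casselsTate_pairing (K := ℚ)) (hΔ : 0 < W.Δ) (hT : NoRationalTwoTorsion W)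
    {d d' : ℤ} (hd : DescAdmissible W d) (hd' : DescAdmissible W d') : twistSelmerTwoCard W d = twistSelmerTwoCard W d' :=
  admissibleTwistSelmerLevelAt_of_isSquare W hΔ hd hd' (isSquare_twistSelmerTwoCard_mul_selmerTwoCard_mul_two W hmod hpar hCT hT hd)
    (isSquare_twistSelmerTwoCard_mul_selmerTwoCard_mul_two W hmod hpar hCT hT hd')

/-- **The T-V dichotomy for ONE curve, modulo the three print items** (no rank hypothesis): `Δ_W > 0`, `E(ℚ)[2] = 0`, `#Sel₂(W) = 4` ⟹
every descent-admissible twist has `#Sel₂ = 2`, or every one has `#Sel₂ = 8`. [cite: Kramer1981, §2 Prop. 6, Thm. 1]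
[cite: MazurRubin2010, Cor. 3.4 (i)] [cite: CremonaMazur2000, §3] -/
theorem strictShaPropagationAt_of_print (hmod : exists_isNewformOf) (hpar : ∀ V : WeierstrassCurve ℚ, p_parity V 2)
    (hCT : WeierstrassCurve.exists_casselsTate_pairing (K := ℚ)) (hΔ : 0 < W.Δ) (hT : NoRationalTwoTorsion W)
    (h4 : selmerTwoCard W = 4) :
    (∀ d : ℤ, DescAdmissible W d → twistSelmerTwoCard W d = 2) ∨
      (∀ d : ℤ, DescAdmissible W d → twistSelmerTwoCard W d = 8) :=
  strictShaPropagationAt_of_isSquare W hΔ h4 fun _ hd ↦ isSquare_twistSelmerTwoCard_mul_selmerTwoCard_mul_two W hmod hpar hCT hT hd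

end PerCurve

/-- **T-A `F1Sign2.AdmissibleTwistSelmerShiftAtTwo` BY NAME, modulo {`ModularityExistsNewform`, `TwoParityDD`, `CasselsTatePairingRat`}
only** (the route's print items stmt-19382 / 24949 / 19420; Poitou–Tate and Tate χ are tree theorems): for every globally minimal
elliptic `W/ℚ` with `Δ_W > 0` and `E(ℚ)[2] = 0`, and every descent-admissible `d`, `#Sel₂(W^{(d)})` is `#Sel₂(W)/2` or `2·#Sel₂(W)`. No
Galois-image hypothesis. [cite: Kramer1981, §2 Prop. 6, Thm. 1] [cite: MazurRubin2010, Cor. 3.4 (i)] [cite: DokchitserDokchitserAnnals2010, Thm. 1.4] -/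
theorem admissibleTwistSelmerShiftAtTwo_of_print (hmod : ModularityExistsNewform) (hDD : TwoParityDD)
    (hCT : CasselsTatePairingRat) : AdmissibleTwistSelmerShiftAtTwo :=
  fun W _ _ hΔ hT _ hd ↦ admissibleTwistSelmerShiftAt_of_isSquare W hΔ hd
    (isSquare_twistSelmerTwoCard_mul_selmerTwoCard_mul_two_of_parity W hmod hCT hT hd (hDD W) (hDD _))

/-- **T-A′ `F1Sign2.AdmissibleTwistSelmerLevelAtTwo` BY NAME, modulo the same three print items**: `#Sel₂(W^{(d)}) = #Sel₂(W^{(d')})` for all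
descent-admissible `d, d'` — the well-definedness of the descent sign `ε(W)`. [cite: Kramer1981, §2 Prop. 6, Thm. 1] [cite: MazurRubin2010, Cor. 3.4 (i)] -/
theorem admissibleTwistSelmerLevelAtTwo_of_print (hmod : ModularityExistsNewform) (hDD : TwoParityDD)
    (hCT : CasselsTatePairingRat) : AdmissibleTwistSelmerLevelAtTwo :=
  fun W _ _ hΔ hT _ _ hd hd' ↦ admissibleTwistSelmerLevelAt_of_isSquare W hΔ hd hd'
    (isSquare_twistSelmerTwoCard_mul_selmerTwoCard_mul_two_of_parity W hmod hCT hT hd (hDD W) (hDD _))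
    (isSquare_twistSelmerTwoCard_mul_selmerTwoCard_mul_two_of_parity W hmod hCT hT hd' (hDD W) (hDD _))

/-- **T-V `F1Sign2.StrictShaPropagationAtTwo` BY NAME, modulo the same three print items**: for `Δ_W > 0`, `E(ℚ)[2] = 0`, `#Sel₂(W) = 4`,
either every descent-admissible twist has `#Sel₂ = 2` or every one has `#Sel₂ = 8` (the rank hypothesis of T-V is not used).
[cite: Kramer1981, §2 Prop. 6, Thm. 1] [cite: MazurRubin2010, Cor. 3.4 (i)] [cite: CremonaMazur2000, §3] -/
theorem strictShaPropagationAtTwo_of_print (hmod : ModularityExistsNewform) (hDD : TwoParityDD)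
    (hCT : CasselsTatePairingRat) : StrictShaPropagationAtTwo :=
  fun W _ _ hΔ hT _ h4 ↦ strictShaPropagationAt_of_isSquare W hΔ h4 fun _ hd ↦
    isSquare_twistSelmerTwoCard_mul_selmerTwoCard_mul_two_of_parity W hmod hCT hT hd (hDD W) (hDD _)

/-- **T-C `F1Sign2.EggTwistLawAtTwo` BY NAME, modulo the same three print items**: rank one, `Ш(W)[2] = 0`, `Δ_W > 0`, `E(ℚ)[2] = 0`: if
`E(ℚ)` meets the egg every descent-admissible twist has `#Sel₂ = 1` (file 31's `eggTwistLaw_meetsEgg`, unconditional), otherwise every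
one has `#Sel₂ = 4` (file 30's dictionary `¬ MeetsEgg ⟹ Sel₂(W)` strict at `∞`, UP with the root-number parity, `#Sel₂(W) = 2`).
[cite: Kramer1981, §2 Prop. 6, Thm. 1] [cite: MazurRubin2010, Cor. 3.4 (i)] [cite: DokchitserDokchitserAnnals2010, Thm. 1.4] -/
theorem eggTwistLawAtTwo_of_print (hmod : ModularityExistsNewform) (hDD : TwoParityDD) (hCT : CasselsTatePairingRat) :
    EggTwistLawAtTwo := by
  intro W _ _ hΔ hT hrank hSha d hd
  refine ⟨fun hegg ↦ eggTwistLaw_meetsEgg W hΔ hT hrank hSha hd hegg, fun hegg ↦ ?_⟩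
  have h := twistSelmerTwoCard_eq_two_mul_of_strict_of_isSquare W (poitouTate_selmerStructure_duality_real_holds (K := ℚ))
    (GenusKolyLowering.localEP ℚ) hΔ (forall_mem_selmerGroup_localization_inl_eq_zero_of_not_meetsEgg W hΔ hT hSha hegg) hd
    (isSquare_twistSelmerTwoCard_mul_selmerTwoCard_mul_two_of_parity W hmod hCT hT hd (hDD W) (hDD _))
  rw [selmerTwoCard_eq_two_of_rank_one W hT hrank hSha] at h
  exact h

/-- **The descent sign is the egg, BY the print items** (no habitat hypothesis): for `W/ℚ` globally minimal elliptic with `Δ_W > 0`,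
`E(ℚ)[2] = 0`, `Ш(W)[2] = 0`: `¬ F1Sign2.DescentSignNeg W ↔ MeetsEgg W`. [cite: Kramer1981, §2 Prop. 6, Thm. 1] [cite: MazurRubin2010, Cor. 3.4 (i)] -/
theorem not_descentSignNeg_iff_meetsEgg_of_print (hmod : ModularityExistsNewform) (hDD : TwoParityDD) (hCT : CasselsTatePairingRat)
    (W : WeierstrassCurve ℚ) [W.IsElliptic] [W.IsGloballyMinimal] (hΔ : 0 < W.Δ) (hT : NoRationalTwoTorsion W)
    (hSha : ShaTwoTrivial W) (hex : ∃ d : ℤ, DescAdmissible W d) : ¬ DescentSignNeg W ↔ MeetsEgg W := by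
  have hPT := poitouTate_selmerStructure_duality_real_holds (K := ℚ)
  have hEP := GenusKolyLowering.localEP ℚ
  have h0 : selmerTwoCard W ≠ 0 := by
    rw [selmerTwoCard]
    haveI : Finite (W.selmerGroup 2) := W.finite_selmerGroup_holds (by norm_num)
    haveI : Nonempty (W.selmerGroup 2) := ⟨0⟩
    exact Nat.card_pos.ne'
  rw [meetsEgg_iff_exists_localization_inl_ne_zero W hΔ hT hSha]
  constructor
  · intro hns
    by_contra hstrict
    push Not at hstrict
    obtain ⟨d, hd⟩ := hex
    exact hns ⟨d, hd, twistSelmerTwoCard_eq_two_mul_of_strict_of_isSquare W hPT hEP hΔ hstrict hd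
      (isSquare_twistSelmerTwoCard_mul_selmerTwoCard_mul_two_of_parity W hmod hCT hT hd (hDD W) (hDD _))⟩
  · rintro ⟨c, hc, hne⟩ ⟨d, hd, h2⟩
    have h := two_mul_twistSelmerTwoCard_eq_of_exists W hPT hEP hΔ ⟨c, hc, hne⟩ hd
    omega

end ByName

end Summit.BirchSwinnertonDyer.BirchSwinnertonDyer.Theorems.GenusKolyArch

end
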